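import Summits.QuantumFields.YangMills.Theorems.UnitScaleTiltProp7TwoBackgroundGradientComparison
import HarnessLib

/-!
# Route `UnitScaleTilt`, crux K1 «MinimiserStabilityRegPr» (stmt-QuantumFields-19200), EX row (5) `h3` (STOREY H), pipeline (ii) H2-LOC — **THE AGMON `L²` ROW OF
# `w = G_1 D*_V x` ON `ℓ`-BALLS, GAUGE-FREE, AT ANY BACKGROUND**: `Σ_{tdist(y₀,y) ≤ ℓ} ‖w(y)‖² ≤ 9·192³·ℓ³·X²` whenever `Δ^η_V w + w = D*_V x` and `‖x(b)‖ ≤ X`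

Cell `ym3-torus` (HUMAN RULING D-0037; rung R3 = SU(2) YM₃ on T³ — NOT d = 4, NOT infinite volume, NOT a mass gap, NOT Clay).  Seat `ym-line-cst-p1` (gen 38, free prover
hand; chair ★p1 g28 CHAIR WORD №62 «hWsup supplier», px19 g16 17:15:47Z «hWsup ⟸ hHlocV + ONE gauge-free Agmon L² row + (i)»; LOCATE `LOCATE-hWsup-supplier-cstp1g38.md` c1d4da4e,
19200 evidence #42).  `--supports stmt-QuantumFields-19200 --as helper`; count-neutral; THEOREMS ONLY (0 `def`, 0 `sorry`, 0 `instance`, default heartbeats).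

WHY.  STOREY H's sup letter `hWsup` (px19 g16 text `H2LOC-LETTER-hWsup.px19g16.txt` a03f6c184c689677: for `RegPr` backgrounds, `Δ^η_{U₀} w + w = D*_{U₀} x` with `‖x‖_∞ ≤ X` ⇒
`‖w‖_∞ ≤ Cw·X`, `Cw` K-free) is supplied by a bootstrap from (a) the local ½-Hölder letter `hHlocV` (857ccd79) in a local axial gauge on the cover and (b) an `L²` bound on
`ℓ`-balls that needs NO regularity and NO gauge: the present file is (b).  The point of the estimate: in lattice units the equation reads `(L_V + ℓ⁻²)w = ℓ⁻¹·(D*_lat x)` —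
the divergence carries `η⁻¹ = ℓ` exactly ONCE (✓`norm_inv_eta`), and testing against `χ²w` with the exponential weight `χ = exp(−tdist(y₀,·)∕(32ℓ))` produces commutator terms
`η⁻¹(χ(b₊)² − χ(b₋)²)` of size `ℓ·(2s·e^s)·χ₊χ₋ ≤ (2e^{1∕32}∕32)·χ₊χ₋` (`s = 1∕(32ℓ)`) — K-FREE — which the mass term absorbs (Agmon ∕ Combes–Thomas; [Balaban1985BackgroundPropagators]
(3.40) p.397 is the print locus of the weighted quadratic-form method for `Δ^η_U + a`).  By duality `|w(y₀)| ≤ ℓ⁻¹X‖∇G_ℓδ‖_{ℓ¹} ≍ X` is sharp, so a constant `Cw` is the truth.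

WHAT IS PROVED (ns `…Theorems.Prop7MassiveDivergenceAgmonRow`; member `F n K`, weight `c₀ > 0`, ANY background `V`).  §0 scalar letters (`exp_sub_exp_neg_le`, `abs_sq_sub_sq_le`: `|χ₁² − χ₂²| ≤
(2s e^s)·χ₁χ₂` for `|t₁ − t₂| ≤ 1`; `ell_mul_rate_le`: `ℓ·(2s e^s) ≤ 2e^{1∕a}∕a` at `s = 1∕(aℓ)`); §1 `energy_identity` (`⟪D_Vφ, D_Vw⟫ + ⟪φ, w⟫ = ⟪D_Vφ, x⟫`, ✓`adjoint_DL2`) and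
★ `equiv_DL2_weightTest` (discrete Leibniz rule `D_V(χ²w)(b) = χ(b₊)²(D_Vw)(b) + η⁻¹(χ(b₊)² − χ(b₋)²)·w(b₋)`); §2 ★ `bond_young` (bond-by-bond Young inequality in the fibre);
§3 ★★ `weighted_mass_le` (ANY weight `χ ≥ 0` with K-free bond commutator `ℓ|χ(b₊)² − χ(b₋)²| ≤ kχ(b₊)χ(b₋)`, `k ≤ 1∕5` ⇒ `Σ_y χ²‖w‖² ≤ (3∕2)X²Σ_yΣ_μ χ(y+e_μ)²`); §4
`sum_weight_sq_le` (`Σ_y e^{−2tdist∕(32ℓ)} ≤ 192³ℓ³`, lit ✓`B4Sect5Torus.torusSum_le`) and ★★★ `sq_sum_ball_le_of_massive_divergence` — THE ROW (statement text frozen as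
`AROW-STATEMENT-TEXT.cstp1g38.txt` 66fef776ef296e9d; px5 g16's DOOR `hWsup_of_hHlocV` consumes it as `hArow` with `C_A := 9·192³`).
HYP-SAT (★★OWNER RULING №42).  Hypotheses: one equation between displayed terms and a sup row on `x` (inhabited by `w = 0, x = 0`); conclusion a real inequality; no `Prop`
placeholder, no background smallness, no gauge letter, no room.
HONEST SCOPE.  [folklore] lattice analysis at the member; `hWsup` itself (the DOOR), `hHlocV`, H2 FILE 2, `h3`, norm_G, EX, 19200 are NOT proved here; nothing about d = 4, the
continuum limit or a mass gap; the Yang–Mills mass gap is NOT proved.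

References: T. Bałaban, CMP **99** (1985) 389–434 [Balaban1985BackgroundPropagators] ((3.3) p.391, (3.8) p.392, (3.11) p.392, (3.23) p.394, (3.40) p.397, Thm 3.1 (3.43) p.398);
CMP **96** (1984) 223–250 [Balaban1984PropagatorsII] (Lemma 2.1 p.234); S. Agmon, *Lectures on exponential decay of solutions of second-order elliptic equations* (1982)
[Agmon1982] (Thm 1.5 p.19).
-/

set_option autoImplicit false

noncomputable section

open scoped InnerProductSpace ComplexConjugate BigOperators

namespace Summit.QuantumFields.YangMills.Theorems.Prop7MassiveDivergenceAgmonRow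

open Literature.MathematicalPhysics.QuantumFieldTheory.Balaban1983to89
open Literature.MathematicalPhysics.QuantumFieldTheory.Balaban1983to89.T3ContinuumYM3Torus
open B4Sect5Torus (TSite tdist tdist_triangle tdist_symm tdist_nonneg torusSum_le)
open B9SectCLatticeCarrier (Bond shift tdist_shift_le)
open B9Eq311L2Pairing (WL2)
open B11Eq103H1Complex (SiteL2K BondL2K)
open T3SectALandauChart (eta eta_pos)
open Summit.QuantumFields.YangMills.Theorems.Prop7SectET3Transport (periodsT3)
open Summit.QuantumFields.YangMills.Theorems.Prop7SectET3HilbertLetters (W₂ adBg DL2 DstarL2 covLapSite adjoint_DL2)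
open Summit.QuantumFields.YangMills.Theorems.Prop7KatoBootstrapMember (norm_adBg_eq)
open Summit.QuantumFields.YangMills.Theorems.Prop7TwoBackgroundGradientComparison (equiv_DL2_apply norm_inv_eta one_le_periodsT3)

/-! ## §0 Scalar letters -/

/-- `exp s − exp (−s) ≤ 2 · s · exp s` for `0 ≤ s`. [folklore] -/
theorem exp_sub_exp_neg_le {s : ℝ} (hs : 0 ≤ s) : Real.exp s - Real.exp (-s) ≤ 2 * s * Real.exp s := by
  have h1 : 1 - s ≤ Real.exp (-s) := by have := Real.add_one_le_exp (-s); linarith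
  -- `exp s − 1 ≤ s·exp s` (lit ✓`AreaLaw.exp_sub_one_le_mul_exp`, re-derived in two lines to keep the imports local)
  have h2 : Real.exp s * (1 - s) ≤ Real.exp s * Real.exp (-s) := mul_le_mul_of_nonneg_left h1 (Real.exp_pos s).le
  rw [← Real.exp_add, add_neg_cancel, Real.exp_zero] at h2
  nlinarith [Real.one_le_exp hs, Real.exp_pos s]

/-- For `|u| ≤ s`: `|exp u − exp (−u)| ≤ 2 · s · exp s`. [folklore] -/
theorem abs_exp_sub_exp_neg_le {u s : ℝ} (hu : |u| ≤ s) : |Real.exp u - Real.exp (-u)| ≤ 2 * s * Real.exp s := by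
  have hs : 0 ≤ s := (abs_nonneg u).trans hu
  rcases le_total 0 u with h | h
  · have hu' : u ≤ s := (le_abs_self u).trans hu
    rw [abs_of_nonneg (by linarith [Real.exp_le_exp.2 (show -u ≤ u by linarith)])]
    calc Real.exp u - Real.exp (-u) ≤ 2 * u * Real.exp u := exp_sub_exp_neg_le h
      _ ≤ 2 * s * Real.exp s := by nlinarith [Real.exp_le_exp.2 hu', Real.exp_pos u]
  · have hu' : -u ≤ s := (neg_le_abs u).trans hu
    rw [abs_of_nonpos (by linarith [Real.exp_le_exp.2 (show u ≤ -u by linarith)])]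
    calc -(Real.exp u - Real.exp (-u)) = Real.exp (-u) - Real.exp (-(-u)) := by rw [neg_neg]; ring
      _ ≤ 2 * (-u) * Real.exp (-u) := exp_sub_exp_neg_le (by linarith)
      _ ≤ 2 * s * Real.exp s := by nlinarith [Real.exp_le_exp.2 hu', Real.exp_pos (-u)]

/-- THE WEIGHT COMPARISON: for `t₁, t₂ ≥ 0` with `|t₁ − t₂| ≤ 1` and `s > 0`, the weights `χᵢ = exp(−tᵢ s)` satisfy
`|χ₁² − χ₂²| ≤ (2 s · exp s) · χ₁ χ₂`. [folklore] -/
theorem abs_sq_sub_sq_le {t₁ t₂ s : ℝ} (hs : 0 ≤ s) (h : |t₁ - t₂| ≤ 1) :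
    |Real.exp (-(t₁ * s)) ^ 2 - Real.exp (-(t₂ * s)) ^ 2| ≤
      (2 * s * Real.exp s) * (Real.exp (-(t₁ * s)) * Real.exp (-(t₂ * s))) := by
  have hA : Real.exp (-(t₁ * s)) * Real.exp (-(t₂ * s)) * Real.exp ((t₂ - t₁) * s) = Real.exp (-(t₁ * s)) ^ 2 := by
    rw [sq, ← Real.exp_add, ← Real.exp_add, ← Real.exp_add]; congr 1; ring
  have hB : Real.exp (-(t₁ * s)) * Real.exp (-(t₂ * s)) * Real.exp (-((t₂ - t₁) * s)) = Real.exp (-(t₂ * s)) ^ 2 := by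
    rw [sq, ← Real.exp_add, ← Real.exp_add, ← Real.exp_add]; congr 1; ring
  have key : Real.exp (-(t₁ * s)) ^ 2 - Real.exp (-(t₂ * s)) ^ 2 =
      (Real.exp (-(t₁ * s)) * Real.exp (-(t₂ * s))) * (Real.exp ((t₂ - t₁) * s) - Real.exp (-((t₂ - t₁) * s))) := by
    rw [mul_sub, hA, hB]
  rw [key, abs_mul, abs_of_pos (mul_pos (Real.exp_pos _) (Real.exp_pos _)), mul_comm]
  refine mul_le_mul_of_nonneg_right (abs_exp_sub_exp_neg_le ?_) (by positivity)
  rw [abs_mul, abs_of_nonneg hs]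
  calc |t₂ - t₁| * s ≤ 1 * s := mul_le_mul_of_nonneg_right (by rw [abs_sub_comm]; exact h) hs
    _ = s := one_mul s

/-- `ℓ · (2 s exp s) ≤ 2 exp(1∕a) ∕ a` at `s = 1∕(aℓ)`, `ℓ ≥ 1`, `a > 0` — the commutator factor is K-FREE. [folklore] -/
theorem ell_mul_rate_le {ℓ a : ℝ} (hℓ : 1 ≤ ℓ) (ha : 0 < a) :
    ℓ * (2 * (a * ℓ)⁻¹ * Real.exp ((a * ℓ)⁻¹)) ≤ 2 * Real.exp a⁻¹ / a := by
  have hℓ0 : 0 < ℓ := by linarith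
  have h1 : ℓ * (2 * (a * ℓ)⁻¹) = 2 / a := by field_simp
  have h2 : Real.exp ((a * ℓ)⁻¹) ≤ Real.exp a⁻¹ := Real.exp_le_exp.2 <| by
    rw [mul_inv]; exact mul_le_of_le_one_right (inv_pos.2 ha).le (inv_le_one_of_one_le₀ hℓ)
  calc ℓ * (2 * (a * ℓ)⁻¹ * Real.exp ((a * ℓ)⁻¹)) = (2 / a) * Real.exp ((a * ℓ)⁻¹) := by rw [← h1]; ring
    _ ≤ (2 / a) * Real.exp a⁻¹ := mul_le_mul_of_nonneg_left h2 (by positivity)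
    _ = 2 * Real.exp a⁻¹ / a := by ring

/-! ## §1 The member: the energy identity against a test function, and the weighted test function -/

section Member

variable (F : T3Family) (n K : ℕ) (c₀ : ℝ) [Fact (0 < c₀)]

/-- THE ENERGY IDENTITY WITH A TEST FUNCTION: if `Δ^η_V w + w = D*_V x` then `⟪D_Vφ, D_Vw⟫ + ⟪φ, w⟫ = ⟪D_Vφ, x⟫` for every `φ` (`Δ^η_V = D*_VD_V`, `D*_V = D_V†`).
[cite: Balaban1985BackgroundPropagators, (3.23) p.394, (3.8) p.392] -/
theorem energy_identity (V : GaugeField (F.P K) 0 (Matrix.specialUnitaryGroup (Fin 2) ℂ))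
    (w φ : SiteL2K ℂ 3 (periodsT3 F K) c₀ W₂) (x : BondL2K ℂ 3 (periodsT3 F K) c₀ W₂)
    (h : covLapSite F n K c₀ V w + ((1 : ℝ) : ℂ) • w = DstarL2 F n K c₀ V x) :
    ⟪DL2 F n K c₀ V φ, DL2 F n K c₀ V w⟫_ℂ + ⟪φ, w⟫_ℂ = ⟪DL2 F n K c₀ V φ, x⟫_ℂ := by
  have h1 := congrArg (fun z => ⟪φ, z⟫_ℂ) h
  simp only [Complex.ofReal_one, one_smul, inner_add_right] at h1
  have h2 : ⟪φ, covLapSite F n K c₀ V w⟫_ℂ = ⟪DL2 F n K c₀ V φ, DL2 F n K c₀ V w⟫_ℂ := by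
    rw [Prop7TwoBackgroundGradientComparison.covLapSite_apply, ← adjoint_DL2, LinearMap.adjoint_inner_right]
  have h3 : ⟪φ, DstarL2 F n K c₀ V x⟫_ℂ = ⟪DL2 F n K c₀ V φ, x⟫_ℂ := by
    rw [← adjoint_DL2, LinearMap.adjoint_inner_right]
  rw [← h2, ← h3]; exact h1

omit [Fact (0 < c₀)] in
/-- THE WEIGHTED TEST FUNCTION `φ = χ²·w` for a real site weight `χ`. [cite: Balaban1985BackgroundPropagators, (3.40) p.397] -/
theorem equiv_weightTest (χ : TSite 3 (periodsT3 F K) → ℝ) (w : SiteL2K ℂ 3 (periodsT3 F K) c₀ W₂) (y : TSite 3 (periodsT3 F K)) :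
    WL2.equiv ℂ (fun _ : TSite 3 (periodsT3 F K) => c₀) W₂
        ((WL2.equiv ℂ (fun _ : TSite 3 (periodsT3 F K) => c₀) W₂).symm
          fun z => (((χ z) ^ 2 : ℝ) : ℂ) • WL2.equiv ℂ (fun _ : TSite 3 (periodsT3 F K) => c₀) W₂ w z) y
      = (((χ y) ^ 2 : ℝ) : ℂ) • WL2.equiv ℂ (fun _ : TSite 3 (periodsT3 F K) => c₀) W₂ w y := by
  rw [Equiv.apply_symm_apply]

/-- `D_V(χ²w)(y,μ) = χ(y+e_μ)²·(D_Vw)(y,μ) + η⁻¹(χ(y+e_μ)² − χ(y)²)·w(y)` — the discrete Leibniz rule through the transporter (linear in the fibre).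
[cite: Balaban1985BackgroundPropagators, (3.3) p.391] -/
theorem equiv_DL2_weightTest (V : GaugeField (F.P K) 0 (Matrix.specialUnitaryGroup (Fin 2) ℂ)) (χ : TSite 3 (periodsT3 F K) → ℝ)
    (w : SiteL2K ℂ 3 (periodsT3 F K) c₀ W₂) (y : TSite 3 (periodsT3 F K)) (μ : Fin 3) :
    WL2.equiv ℂ (fun _ : Bond 3 (periodsT3 F K) => c₀) W₂
        (DL2 F n K c₀ V ((WL2.equiv ℂ (fun _ : TSite 3 (periodsT3 F K) => c₀) W₂).symm
          fun z => (((χ z) ^ 2 : ℝ) : ℂ) • WL2.equiv ℂ (fun _ : TSite 3 (periodsT3 F K) => c₀) W₂ w z)) (y, μ)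
      = (((χ (shift μ y)) ^ 2 : ℝ) : ℂ) • WL2.equiv ℂ (fun _ : Bond 3 (periodsT3 F K) => c₀) W₂ (DL2 F n K c₀ V w) (y, μ)
        + ((((eta F n K : ℝ) : ℂ))⁻¹ * ((((χ (shift μ y)) ^ 2 : ℝ) : ℂ) - (((χ y) ^ 2 : ℝ) : ℂ))) •
          WL2.equiv ℂ (fun _ : TSite 3 (periodsT3 F K) => c₀) W₂ w y := by
  rw [equiv_DL2_apply, equiv_DL2_apply, equiv_weightTest, equiv_weightTest, map_smul]
  module

end Member

/-! ## §2 The bond-by-bond Young inequality and the weighted mass estimate -/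

section Fibre

variable {W : Type*} [NormedAddCommGroup W] [InnerProductSpace ℂ W]

/-- `re ⟪(a:ℂ)•u, z⟫ = a · re ⟪u, z⟫` for real `a`. [folklore] -/
theorem re_inner_ofReal_smul_left (a : ℝ) (u z : W) : (⟪(a : ℂ) • u, z⟫_ℂ).re = a * (⟪u, z⟫_ℂ).re := by
  rw [inner_smul_left, Complex.conj_ofReal, Complex.re_ofReal_mul]

/-- `re ⟪c•v, z⟫ ≤ ‖c‖‖v‖‖z‖`. [folklore] -/
theorem re_inner_smul_left_le (c : ℂ) (v z : W) : (⟪c • v, z⟫_ℂ).re ≤ ‖c‖ * ‖v‖ * ‖z‖ := by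
  calc (⟪c • v, z⟫_ℂ).re ≤ ‖⟪c • v, z⟫_ℂ‖ := Complex.re_le_norm _
    _ ≤ ‖c • v‖ * ‖z‖ := norm_inner_le_norm _ _
    _ = ‖c‖ * ‖v‖ * ‖z‖ := by rw [norm_smul]

/-- `−‖c‖‖v‖‖z‖ ≤ re ⟪c•v, z⟫`. [folklore] -/
theorem neg_le_re_inner_smul_left (c : ℂ) (v z : W) : -(‖c‖ * ‖v‖ * ‖z‖) ≤ (⟪c • v, z⟫_ℂ).re := by
  have h1 : |(⟪c • v, z⟫_ℂ).re| ≤ ‖⟪c • v, z⟫_ℂ‖ := Complex.abs_re_le_norm _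
  have h2 : ‖⟪c • v, z⟫_ℂ‖ ≤ ‖c‖ * ‖v‖ * ‖z‖ := (norm_inner_le_norm _ _).trans (by rw [norm_smul])
  linarith [neg_abs_le (⟪c • v, z⟫_ℂ).re]

/-- THE BOND-BY-BOND YOUNG INEQUALITY of the Agmon estimate: with `χ₊, χ₋` the weights at the two ends of a bond, a commutator coefficient `‖c‖ ≤ k χ₊ χ₋`,
`0 ≤ k ≤ 1`, data `‖z‖ ≤ X`: `re⟪χ₊²u + c v, z⟫ − re⟪χ₊²u + c v, u⟫ ≤ k χ₋² ‖v‖² + ((1+k)∕2) χ₊² X²`. [folklore] [cite: Balaban1985BackgroundPropagators, (3.40) p.397] -/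
theorem bond_young {χp χm k X : ℝ} (hk0 : 0 ≤ k) (hk1 : k ≤ 1) (hp : 0 ≤ χp) (hm : 0 ≤ χm)
    (c : ℂ) (hc : ‖c‖ ≤ k * (χp * χm)) (u v z : W) (hz : ‖z‖ ≤ X) :
    (⟪((χp ^ 2 : ℝ) : ℂ) • u + c • v, z⟫_ℂ).re - (⟪((χp ^ 2 : ℝ) : ℂ) • u + c • v, u⟫_ℂ).re
      ≤ k * (χm ^ 2 * ‖v‖ ^ 2) + (1 + k) / 2 * (χp ^ 2 * X ^ 2) := by
  rw [inner_add_left, inner_add_left, Complex.add_re, Complex.add_re, re_inner_ofReal_smul_left, re_inner_ofReal_smul_left]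
  have hD := norm_nonneg u
  have hV := norm_nonneg v
  have huu : (⟪u, u⟫_ℂ).re = ‖u‖ ^ 2 := by rw [inner_self_eq_norm_sq_to_K]; norm_cast
  have huz : (⟪u, z⟫_ℂ).re ≤ ‖u‖ * X :=
    (Complex.re_le_norm _).trans ((norm_inner_le_norm _ _).trans (mul_le_mul_of_nonneg_left hz hD))
  have hcz : (⟪c • v, z⟫_ℂ).re ≤ k * (χp * χm) * ‖v‖ * X := by
    refine (re_inner_smul_left_le c v z).trans (le_of_eq_of_le (by ring) ((mul_le_mul_of_nonneg_right
      (mul_le_mul hc hz (norm_nonneg _) (by positivity)) hV).trans_eq (by ring)))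
  have hcu : -(k * (χp * χm) * ‖v‖ * ‖u‖) ≤ (⟪c • v, u⟫_ℂ).re := by
    refine le_trans ?_ (neg_le_re_inner_smul_left c v u)
    have := mul_le_mul_of_nonneg_right hc (mul_nonneg hV hD)
    nlinarith
  rw [huu]
  have hp2 : 0 ≤ χp ^ 2 := sq_nonneg _
  -- Young three times
  have h4 : χp ^ 2 * (⟪u, z⟫_ℂ).re ≤ χp ^ 2 * (‖u‖ * X) := mul_le_mul_of_nonneg_left huz hp2
  nlinarith [mul_nonneg hp2 (sq_nonneg (‖u‖ - X)), mul_nonneg hk0 (sq_nonneg (χm * ‖v‖ - χp * X)),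
    mul_nonneg hk0 (sq_nonneg (χm * ‖v‖ - χp * ‖u‖)),
    mul_nonneg (sub_nonneg.2 hk1) (mul_nonneg hp2 (sq_nonneg ‖u‖))]

end Fibre

/-! ## §3 The weighted mass estimate at the member (any background) -/

section Mass

variable (F : T3Family) (n K : ℕ) (c₀ : ℝ) [Fact (0 < c₀)]

/-- `re ⟪f, g⟫ = Σ_x c₀ · re ⟪f(x), g(x)⟫` on the uniformly weighted `L²` carriers. [cite: Balaban1985BackgroundPropagators, (3.11) p.392] -/
theorem re_inner_eq_sum {X : Type*} [Fintype X] (f g : WL2 ℂ (fun _ : X => c₀) W₂) :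
    (⟪f, g⟫_ℂ).re = ∑ x, c₀ * (⟪WL2.equiv ℂ (fun _ : X => c₀) W₂ f x, WL2.equiv ℂ (fun _ : X => c₀) W₂ g x⟫_ℂ).re := by
  rw [WL2.inner_def, Complex.re_sum]
  exact Finset.sum_congr rfl fun x _ => by simp [Complex.mul_re]

/-- ★ **THE WEIGHTED MASS ESTIMATE** (Agmon ∕ Combes–Thomas from the mass term, ANY unitary background, no regularity, no room): if `Δ^η_V w + w = D*_V x` with
`‖x(b)‖ ≤ X` and `χ ≥ 0` is a site weight whose bond commutator is K-free — `ℓ·|χ(y+e_μ)² − χ(y)²| ≤ k·χ(y+e_μ)χ(y)` with `k ≤ 1∕5` — then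
`Σ_y χ(y)²‖w(y)‖² ≤ (3∕2)·X²·Σ_y Σ_μ χ(y+e_μ)²`. [cite: Balaban1985BackgroundPropagators, (3.40) p.397, Thm 3.1 p.397] -/
theorem weighted_mass_le (V : GaugeField (F.P K) 0 (Matrix.specialUnitaryGroup (Fin 2) ℂ))
    (w : SiteL2K ℂ 3 (periodsT3 F K) c₀ W₂) (x : BondL2K ℂ 3 (periodsT3 F K) c₀ W₂) {X : ℝ}
    (h : covLapSite F n K c₀ V w + ((1 : ℝ) : ℂ) • w = DstarL2 F n K c₀ V x)
    (hx : ∀ b, ‖WL2.equiv ℂ (fun _ : Bond 3 (periodsT3 F K) => c₀) W₂ x b‖ ≤ X)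
    (χ : TSite 3 (periodsT3 F K) → ℝ) (hχ : ∀ y, 0 ≤ χ y) {k : ℝ} (hk0 : 0 ≤ k) (hk : k ≤ 1 / 5)
    (hcomm : ∀ (y : TSite 3 (periodsT3 F K)) (μ : Fin 3), (F.L : ℝ) ^ (K - n) * |χ (shift μ y) ^ 2 - χ y ^ 2| ≤ k * (χ (shift μ y) * χ y)) :
    ∑ y, χ y ^ 2 * ‖WL2.equiv ℂ (fun _ : TSite 3 (periodsT3 F K) => c₀) W₂ w y‖ ^ 2
      ≤ 3 / 2 * X ^ 2 * ∑ y : TSite 3 (periodsT3 F K), ∑ μ : Fin 3, χ (shift μ y) ^ 2 := by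
  have hc₀ : 0 < c₀ := Fact.out
  set φ : SiteL2K ℂ 3 (periodsT3 F K) c₀ W₂ := (WL2.equiv ℂ (fun _ : TSite 3 (periodsT3 F K) => c₀) W₂).symm
      fun z => (((χ z) ^ 2 : ℝ) : ℂ) • WL2.equiv ℂ (fun _ : TSite 3 (periodsT3 F K) => c₀) W₂ w z with hφ
  have hE := congrArg Complex.re (energy_identity F n K c₀ V w φ x h)
  rw [Complex.add_re, re_inner_eq_sum, re_inner_eq_sum, re_inner_eq_sum] at hE
  have hB : ∑ y, c₀ * (⟪WL2.equiv ℂ (fun _ : TSite 3 (periodsT3 F K) => c₀) W₂ φ y,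
      WL2.equiv ℂ (fun _ : TSite 3 (periodsT3 F K) => c₀) W₂ w y⟫_ℂ).re
      = c₀ * ∑ y, χ y ^ 2 * ‖WL2.equiv ℂ (fun _ : TSite 3 (periodsT3 F K) => c₀) W₂ w y‖ ^ 2 := by
    rw [Finset.mul_sum]
    refine Finset.sum_congr rfl fun y _ => ?_
    rw [hφ, equiv_weightTest, re_inner_ofReal_smul_left, inner_self_eq_norm_sq_to_K]
    norm_cast
  -- the bond terms, bond by bond (`r₁ − r₂ ≤ …` by the Young inequality)
  have hbond : ∀ b : Bond 3 (periodsT3 F K),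
      (⟪WL2.equiv ℂ (fun _ : Bond 3 (periodsT3 F K) => c₀) W₂ (DL2 F n K c₀ V φ) b,
          WL2.equiv ℂ (fun _ : Bond 3 (periodsT3 F K) => c₀) W₂ x b⟫_ℂ).re
        - (⟪WL2.equiv ℂ (fun _ : Bond 3 (periodsT3 F K) => c₀) W₂ (DL2 F n K c₀ V φ) b,
            WL2.equiv ℂ (fun _ : Bond 3 (periodsT3 F K) => c₀) W₂ (DL2 F n K c₀ V w) b⟫_ℂ).re
        ≤ k * (χ b.1 ^ 2 * ‖WL2.equiv ℂ (fun _ : TSite 3 (periodsT3 F K) => c₀) W₂ w b.1‖ ^ 2)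
            + (1 + k) / 2 * (χ (shift b.2 b.1) ^ 2 * X ^ 2) := by
    rintro ⟨y, μ⟩
    rw [hφ, equiv_DL2_weightTest]
    refine bond_young hk0 (by linarith) (hχ _) (hχ _) _ ?_ _ _ _ (hx _)
    rw [norm_mul, norm_inv_eta, ← Complex.ofReal_sub, Complex.norm_real, Real.norm_eq_abs]
    exact hcomm y μ
  rw [hB, ← Finset.mul_sum, ← Finset.mul_sum, ← mul_add] at hE
  have hE' := mul_left_cancel₀ hc₀.ne' hE
  set B := ∑ y, χ y ^ 2 * ‖WL2.equiv ℂ (fun _ : TSite 3 (periodsT3 F K) => c₀) W₂ w y‖ ^ 2 with hBdef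
  set E := ∑ y : TSite 3 (periodsT3 F K), ∑ μ : Fin 3, χ (shift μ y) ^ 2 with hEdef
  have hE0 : 0 ≤ E := Finset.sum_nonneg fun y _ => Finset.sum_nonneg fun μ _ => sq_nonneg _
  have hsum := Finset.sum_le_sum fun b (_ : b ∈ Finset.univ) => hbond b
  rw [Finset.sum_sub_distrib, Finset.sum_add_distrib, ← Finset.mul_sum, ← Finset.mul_sum] at hsum
  have h3B : ∑ b : Bond 3 (periodsT3 F K), χ b.1 ^ 2 * ‖WL2.equiv ℂ (fun _ : TSite 3 (periodsT3 F K) => c₀) W₂ w b.1‖ ^ 2 = 3 * B := by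
    rw [hBdef, Fintype.sum_prod_type, Finset.mul_sum]
    refine Finset.sum_congr rfl fun y _ => ?_
    simp only [Finset.sum_const, Finset.card_univ, Fintype.card_fin, nsmul_eq_mul, Nat.cast_ofNat]
  have hEE : ∑ b : Bond 3 (periodsT3 F K), χ (shift b.2 b.1) ^ 2 * X ^ 2 = E * X ^ 2 := by
    rw [hEdef, Fintype.sum_prod_type, Finset.sum_mul]
    exact Finset.sum_congr rfl fun y _ => by rw [Finset.sum_mul]
  rw [h3B, hEE] at hsum
  have hmain : B ≤ k * (3 * B) + (1 + k) / 2 * (E * X ^ 2) := by linarith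
  nlinarith [mul_nonneg hE0 (sq_nonneg X)]

end Mass

/-! ## §4 The exponential weight and ★★★ the Agmon `L²` row on `ℓ`-balls -/

section Row

variable (F : T3Family) (n K : ℕ) (c₀ : ℝ) [Fact (0 < c₀)]

/-- `1 ≤ ℓ = L^{K−n}`. [cite: Balaban1985BackgroundPropagators, (3.1) p.390] -/
theorem one_le_ell : (1 : ℝ) ≤ (F.L : ℝ) ^ (K - n) :=
  one_le_pow₀ (by exact_mod_cast F.hL.2.le)

/-- THE RADIAL SUM OF THE SQUARED WEIGHT: `Σ_y exp(−tdist(y₀,y)∕(32ℓ))² ≤ 192³·ℓ³`. [cite: Balaban1985BackgroundPropagators, (3.40) p.397] -/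
theorem sum_weight_sq_le (y₀ : TSite 3 (periodsT3 F K)) :
    ∑ y : TSite 3 (periodsT3 F K), Real.exp (-(tdist (periodsT3 F K) y₀ y * (32 * (F.L : ℝ) ^ (K - n))⁻¹)) ^ 2
      ≤ 192 ^ 3 * ((F.L : ℝ) ^ (K - n)) ^ 3 := by
  set ℓ : ℝ := (F.L : ℝ) ^ (K - n) with hℓ
  have hℓ1 : 1 ≤ ℓ := one_le_ell F n K
  set s : ℝ := (32 * ℓ)⁻¹ with hs
  have hs0 : 0 < s := by positivity
  have hP1 : ∀ i, 1 ≤ periodsT3 F K i := one_le_periodsT3 F K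
  have hsq : ∀ y, Real.exp (-(tdist (periodsT3 F K) y₀ y * s)) ^ 2 = Real.exp (-((2 * s) * tdist (periodsT3 F K) y₀ y)) := by
    intro y; rw [sq, ← Real.exp_add]; congr 1; ring
  simp only [hsq]
  refine (torusSum_le 3 hP1 (by positivity : 0 < 2 * s) y₀).trans ?_
  -- `latticeConst 3 (2s) = (2(1 − e^{−2s/3})⁻¹)³ ≤ (6/s)³ = (192ℓ)³`
  -- `u/2 ≤ 1 − e^{−u}` on `[0,1]` (lit ✓`PrimeReciprocal.half_le_one_sub_exp_neg`, re-derived from `1 + u ≤ e^u` to keep the imports local)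
  have hu1 : 2 * s / 3 ≤ 1 := by
    have : (32 * ℓ)⁻¹ ≤ 1 := inv_le_one_of_one_le₀ (by linarith)
    rw [hs]; linarith
  have hlow : 2 * s / 3 / 2 ≤ 1 - Real.exp (-(2 * s / 3)) := by
    have h2 : 1 + 2 * s / 3 ≤ Real.exp (2 * s / 3) := by have := Real.add_one_le_exp (2 * s / 3); linarith
    have h : Real.exp (-(2 * s / 3)) * (1 + 2 * s / 3) ≤ 1 := by
      calc Real.exp (-(2 * s / 3)) * (1 + 2 * s / 3) ≤ Real.exp (-(2 * s / 3)) * Real.exp (2 * s / 3) :=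
            mul_le_mul_of_nonneg_left h2 (Real.exp_pos _).le
        _ = 1 := by rw [← Real.exp_add, neg_add_cancel, Real.exp_zero]
    nlinarith [Real.exp_pos (-(2 * s / 3)), hs0, hu1]
  have hpos : 0 < 1 - Real.exp (-(2 * s / 3)) := lt_of_lt_of_le (by positivity) hlow
  have hinv : (1 - Real.exp (-(2 * s / 3)))⁻¹ ≤ 3 / s := by
    rw [inv_le_comm₀ hpos (by positivity)]; exact le_of_eq_of_le (by field_simp) hlow
  have h6 : 2 * (1 - Real.exp (-(2 * s / 3)))⁻¹ ≤ 192 * ℓ := by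
    calc 2 * (1 - Real.exp (-(2 * s / 3)))⁻¹ ≤ 2 * (3 / s) := mul_le_mul_of_nonneg_left hinv (by norm_num)
      _ = 192 * ℓ := by rw [hs]; field_simp; ring
  unfold B4Sect5Proof.latticeConst
  have hd : (2 * s / (3 : ℕ) : ℝ) = 2 * s / 3 := by norm_num
  rw [hd]
  calc (2 * (1 - Real.exp (-(2 * s / 3)))⁻¹) ^ 3 ≤ (192 * ℓ) ^ 3 :=
        pow_le_pow_left₀ (mul_nonneg (by norm_num) (inv_nonneg.2 hpos.le)) h6 3
    _ = 192 ^ 3 * ℓ ^ 3 := by ring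

/-- ★★★ **THE AGMON `L²` ROW ON `ℓ`-BALLS** (gauge-free, ANY unitary background `V`, no regularity, no room, K-free constant): if `Δ^η_V w + w = D*_V x` on the member
`F n K` and `‖x(b)‖ ≤ X` for every bond, then for every site `y₀`
`Σ_{tdist(y₀,y) ≤ ℓ} ‖w(y)‖² ≤ 9·192³·ℓ³·X²`, `ℓ = L^{K−n}`.  The `L²`-half of the supplier of STOREY H's `hWsup` letter (px19 g16 text a03f6c18): with the local Hölder
letter `hHlocV` at scale `τℓ` and a ball count it bootstraps to `sup ‖w‖ ≤ Cw·X`.  Proof: §3 with `χ = exp(−tdist(y₀,·)∕(32ℓ))`, whose bond commutator is K-free because `D*_V`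
carries `η⁻¹ = ℓ` exactly once (`k = 2e^{1∕32}∕32 ≤ 1∕5`); §4's radial sum; on the ball `χ² ≥ e^{−1∕16} ≥ ½`.
[cite: Balaban1985BackgroundPropagators, Thm 3.1 (3.43) p.398, (3.40) p.397; Balaban1984PropagatorsII, Lemma 2.1 p.234] -/
theorem sq_sum_ball_le_of_massive_divergence (V : GaugeField (F.P K) 0 (Matrix.specialUnitaryGroup (Fin 2) ℂ))
    (w : SiteL2K ℂ 3 (periodsT3 F K) c₀ W₂) (x : BondL2K ℂ 3 (periodsT3 F K) c₀ W₂) {X : ℝ}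
    (h : covLapSite F n K c₀ V w + ((1 : ℝ) : ℂ) • w = DstarL2 F n K c₀ V x)
    (hx : ∀ b, ‖WL2.equiv ℂ (fun _ : Bond 3 (periodsT3 F K) => c₀) W₂ x b‖ ≤ X) (y₀ : TSite 3 (periodsT3 F K)) :
    ∑ y ∈ Finset.univ.filter (fun y => tdist (periodsT3 F K) y₀ y ≤ (F.L : ℝ) ^ (K - n)),
        ‖WL2.equiv ℂ (fun _ : TSite 3 (periodsT3 F K) => c₀) W₂ w y‖ ^ 2
      ≤ 9 * 192 ^ 3 * ((F.L : ℝ) ^ (K - n)) ^ 3 * X ^ 2 := by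
  set ℓ : ℝ := (F.L : ℝ) ^ (K - n) with hℓ
  have hℓ1 : 1 ≤ ℓ := one_le_ell F n K
  have hℓ0 : 0 < ℓ := by linarith
  set s : ℝ := (32 * ℓ)⁻¹ with hs
  have hs0 : 0 < s := by positivity
  have hP1 : ∀ i, 1 ≤ periodsT3 F K i := one_le_periodsT3 F K
  set χ : TSite 3 (periodsT3 F K) → ℝ := fun y => Real.exp (-(tdist (periodsT3 F K) y₀ y * s)) with hχ
  have hχ0 : ∀ y, 0 ≤ χ y := fun y => (Real.exp_pos _).le
  set k : ℝ := 2 * Real.exp (32 : ℝ)⁻¹ / 32 with hk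
  have hk0 : 0 ≤ k := by positivity
  have hk5 : k ≤ 1 / 5 := by
    have h1 : Real.exp (32 : ℝ)⁻¹ ≤ Real.exp 1 := Real.exp_le_exp.2 (by norm_num)
    rw [hk]; linarith [Real.exp_one_lt_d9]
  have hcomm : ∀ (y : TSite 3 (periodsT3 F K)) (μ : Fin 3), ℓ * |χ (shift μ y) ^ 2 - χ y ^ 2| ≤ k * (χ (shift μ y) * χ y) := by
    intro y μ
    have hdist : |tdist (periodsT3 F K) y₀ (shift μ y) - tdist (periodsT3 F K) y₀ y| ≤ 1 := by
      rw [abs_sub_le_iff]; constructor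
      · linarith [tdist_triangle hP1 y₀ y (shift μ y), tdist_shift_le hP1 μ y]
      · have h' := tdist_shift_le hP1 μ y
        rw [tdist_symm hP1] at h'
        linarith [tdist_triangle hP1 y₀ (shift μ y) y]
    have hrate : ℓ * (2 * s * Real.exp s) ≤ k := by rw [hk, hs]; exact ell_mul_rate_le hℓ1 (by norm_num)
    calc ℓ * |χ (shift μ y) ^ 2 - χ y ^ 2| ≤ ℓ * ((2 * s * Real.exp s) * (χ (shift μ y) * χ y)) :=
          mul_le_mul_of_nonneg_left (abs_sq_sub_sq_le hs0.le hdist) hℓ0.le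
      _ = (ℓ * (2 * s * Real.exp s)) * (χ (shift μ y) * χ y) := by ring
      _ ≤ k * (χ (shift μ y) * χ y) := mul_le_mul_of_nonneg_right hrate (mul_nonneg (hχ0 _) (hχ0 _))
  have hmass := weighted_mass_le F n K c₀ V w x h hx χ hχ0 hk0 hk5 hcomm
  have hE : ∑ y : TSite 3 (periodsT3 F K), ∑ μ : Fin 3, χ (shift μ y) ^ 2 = 3 * ∑ y, χ y ^ 2 := by
    rw [Finset.sum_comm]
    have hμ : ∀ μ : Fin 3, ∑ y : TSite 3 (periodsT3 F K), χ (shift μ y) ^ 2 = ∑ y, χ y ^ 2 := fun μ =>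
      Equiv.sum_comp (B9Eq33CovDerivVector.shiftEquiv μ) (fun y => χ y ^ 2)
    simp only [hμ, Finset.sum_const, Finset.card_univ, Fintype.card_fin, nsmul_eq_mul, Nat.cast_ofNat]
  have hrad : ∑ y, χ y ^ 2 ≤ 192 ^ 3 * ℓ ^ 3 := sum_weight_sq_le F n K y₀
  have hball : ∀ y ∈ Finset.univ.filter (fun y => tdist (periodsT3 F K) y₀ y ≤ ℓ),
      ‖WL2.equiv ℂ (fun _ : TSite 3 (periodsT3 F K) => c₀) W₂ w y‖ ^ 2
        ≤ 2 * (χ y ^ 2 * ‖WL2.equiv ℂ (fun _ : TSite 3 (periodsT3 F K) => c₀) W₂ w y‖ ^ 2) := by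
    intro y hy
    rw [Finset.mem_filter] at hy
    have ht : tdist (periodsT3 F K) y₀ y * s ≤ 32⁻¹ := by
      calc tdist (periodsT3 F K) y₀ y * s ≤ ℓ * (32 * ℓ)⁻¹ := mul_le_mul_of_nonneg_right hy.2 (by positivity)
        _ = 32⁻¹ := by field_simp
    have hχ2 : 1 / 2 ≤ χ y ^ 2 := by
      have h1 : Real.exp (-(32 : ℝ)⁻¹) ≤ χ y := Real.exp_le_exp.2 (by linarith)
      have h2 : 1 - (32 : ℝ)⁻¹ ≤ Real.exp (-(32 : ℝ)⁻¹) := by have := Real.add_one_le_exp (-(32 : ℝ)⁻¹); linarith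
      nlinarith [Real.exp_pos (-(32 : ℝ)⁻¹)]
    nlinarith [sq_nonneg ‖WL2.equiv ℂ (fun _ : TSite 3 (periodsT3 F K) => c₀) W₂ w y‖]
  calc ∑ y ∈ Finset.univ.filter (fun y => tdist (periodsT3 F K) y₀ y ≤ ℓ), ‖WL2.equiv ℂ (fun _ : TSite 3 (periodsT3 F K) => c₀) W₂ w y‖ ^ 2
      ≤ ∑ y ∈ Finset.univ.filter (fun y => tdist (periodsT3 F K) y₀ y ≤ ℓ),
          2 * (χ y ^ 2 * ‖WL2.equiv ℂ (fun _ : TSite 3 (periodsT3 F K) => c₀) W₂ w y‖ ^ 2) := Finset.sum_le_sum hball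
    _ ≤ ∑ y, 2 * (χ y ^ 2 * ‖WL2.equiv ℂ (fun _ : TSite 3 (periodsT3 F K) => c₀) W₂ w y‖ ^ 2) :=
        Finset.sum_le_sum_of_subset_of_nonneg (Finset.filter_subset _ _) fun y _ _ => by positivity
    _ = 2 * ∑ y, χ y ^ 2 * ‖WL2.equiv ℂ (fun _ : TSite 3 (periodsT3 F K) => c₀) W₂ w y‖ ^ 2 := by rw [Finset.mul_sum]
    _ ≤ 2 * (3 / 2 * X ^ 2 * (3 * ∑ y, χ y ^ 2)) := by rw [← hE]; exact mul_le_mul_of_nonneg_left hmass (by norm_num)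
    _ ≤ 2 * (3 / 2 * X ^ 2 * (3 * (192 ^ 3 * ℓ ^ 3))) := by gcongr
    _ = 9 * 192 ^ 3 * ℓ ^ 3 * X ^ 2 := by ring

end Row

end Summit.QuantumFields.YangMills.Theorems.Prop7MassiveDivergenceAgmonRow

end
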